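import Summits.BirchSwinnertonDyer.BirchSwinnertonDyer.Theorems.ErratumRoadFiveAuxPrimeOfFrobeniusWitness
import Summits.BirchSwinnertonDyer.BirchSwinnertonDyer.Theorems.ErratumRoadFiveAuxPrimeKummerElement
import Summits.BirchSwinnertonDyer.BirchSwinnertonDyer.Theorems.ErratumRoadFiveAuxPrimeKummerDescent
import Literature.NumberTheory.QuadraticFields.RingClassPrimeConductorOrder
import Literature.NumberTheory.QuadraticFields.RingClassConjugatePrimeClass
import HarnessLib

/-!
# The auxiliary prime supply S3♭ of the aux-norm line — assembly (F4)

Helper file for crux `stmt-BirchSwinnertonDyer-19715` (`ErratumRoadFive.EulerHalfNotRamNoInertSetAtFive`),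
line `aux_norm_receptacle` (bsd-idea-9 g8) — the final step (F4) of F1–F4 (seat bsd-line-er5-p1-w2 g5):
it PROVES the statement of the line's stub S3♭ `stub_auxiliaryPrimeSupply` with the definition
`AuxiliaryPrimeSupply W K p q N` unfolded (`auxiliaryPrimeSupply`), from: F1
`RingClass.pow_dvd_orderOf_primeClass_of_inert` (p640886), F2 `exists_auxPrime_of_frobeniusWitness`
(p641931), F3a `exists_preWitness` / `exists_witness_of_kummerExclusion` (p643339), F3b
`not_exists_pow_mul_norm_eq_sq` (p643849) / `smul_eq_of_fixed_by_ker_galoisRep`,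
`exists_fixed_root_of_fixed_by_stabilizer` (KummerDescent).  Nothing here closes 19715; no summit
statement is proved; BSD is proved for no curve.

* `exists_split_primes` — `#{𝔓 ∣ q} = 2` in a quadratic `K`: `q𝓞_K = 𝔮 · τ𝔮`, `𝔮 ≠ τ𝔮`, and
  every prime containing `q` is `𝔮` or `τ𝔮`.
* `embedding_mul_smul_eq_norm` — for `γ₀ ∉ res Γ_K`: `e k · γ₀(e k) = N_{K/ℚ}(k)` (the two
  embeddings of `K` are `e` and `γ₀ ∘ e`).
* `kummerExclusion` — the Kummer exclusion KEX(β) for `β` a generator of `𝔮^{ord[𝔮]}`.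
* **`auxiliaryPrimeSupply`** — S3♭: for every `E` and finite `T` a prime `ℓ₀ ∉ T`, `ℓ₀ ∤ N`, inert
  in `K`, with `p ∤ a_{ℓ₀}(W)` and `p^E ∣ orderOf [𝔭_v]_{ℓ₀}` for every `v ∣ q`.

References: B. H. Gross, LMS LNS 153 (1991), §3, §9 [GrossLMS1991]; D. A. Cox, *Primes of the form
x² + ny²* (2013), §7, §9 [Cox2013].
-/

noncomputable section

set_option linter.dupNamespace false -- `Summit.BirchSwinnertonDyer.BirchSwinnertonDyer` (summit = problem), tree-wide

open scoped Classical NumberField Pointwise nonZeroDivisors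
open WeierstrassCurve NumberField Field IsDedekindDomain
open Literature.NumberTheory.GaloisRepresentations Literature.NumberTheory.EllipticCurves
open Literature.NumberTheory.NumberFields.RingClassField Literature.NumberTheory.QuadraticFields

namespace Summit.BirchSwinnertonDyer.BirchSwinnertonDyer.Theorems.AuxPrimeSupply

/-! ### Split primes in a quadratic field -/

/-- **A split rational prime in a quadratic field**: if exactly two primes of `𝓞_K` lie above `q`,
they are `𝔮` and its conjugate `τ𝔮 ≠ 𝔮` (`τ` the non-trivial automorphism), `q𝓞_K = 𝔮 · τ𝔮`, and
every prime containing `q` is one of them. [cite: Cox2013, §7.B (Prop. 7.20 ff.: splitting in quadratic fields)] -/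
theorem exists_split_primes {K : Type} [Field K] [NumberField K] (hK2 : Module.finrank ℚ K = 2)
    {q : ℕ} (hq : q.Prime) (hq2 : ((Ideal.span {(q : ℤ)}).primesOver (𝓞 K)).ncard = 2) :
    ∃ (τ : K ≃ₐ[ℚ] K) (v₁ v₂ : HeightOneSpectrum (𝓞 K)), τ ≠ 1 ∧ v₁ ≠ v₂ ∧
      v₂.asIdeal = τ • v₁.asIdeal ∧ Ideal.span {(q : 𝓞 K)} = v₁.asIdeal * v₂.asIdeal ∧
      (q : 𝓞 K) ∈ v₁.asIdeal ∧
      ∀ v : HeightOneSpectrum (𝓞 K), (q : 𝓞 K) ∈ v.asIdeal → v = v₁ ∨ v = v₂ := by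
  classical
  haveI : Algebra.IsQuadraticExtension ℚ K := ⟨hK2⟩
  haveI : IsGaloisGroup (K ≃ₐ[ℚ] K) ℤ (𝓞 K) :=
    IsGaloisGroup.of_isFractionRing (K ≃ₐ[ℚ] K) ℤ (𝓞 K) ℚ K
  have hG : Nat.card (K ≃ₐ[ℚ] K) = 2 := by rw [IsGalois.card_aut_eq_finrank, hK2]
  -- a non-trivial automorphism
  obtain ⟨τ, hτ⟩ : ∃ τ : K ≃ₐ[ℚ] K, τ ≠ 1 := by
    haveI : Finite (K ≃ₐ[ℚ] K) := Nat.finite_of_card_ne_zero (by rw [hG]; norm_num)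
    have : Nontrivial (K ≃ₐ[ℚ] K) := Finite.one_lt_card_iff_nontrivial.mp (by rw [hG]; norm_num)
    exact exists_ne 1
  -- the prime `p = (q)` of `ℤ`
  set p : Ideal ℤ := Ideal.span {(q : ℤ)} with hpdef
  have hqprime : Prime (q : ℤ) := Nat.prime_iff_prime_int.mp hq
  haveI hpP : p.IsPrime := (Ideal.span_singleton_prime hqprime.ne_zero).mpr hqprime
  have hp0 : p ≠ ⊥ := by
    rw [hpdef, Ne, Ideal.span_singleton_eq_bot]; exact_mod_cast hq.ne_zero
  haveI hpmax : p.IsMaximal := hpP.isMaximal hp0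
  -- a prime `P` above `p`
  obtain ⟨P, hP⟩ := Set.nonempty_of_ncard_ne_zero (s := p.primesOver (𝓞 K)) (by rw [hq2]; norm_num)
  haveI := hP.1
  haveI := hP.2
  have hP0 : P ≠ ⊥ := Ideal.ne_bot_of_liesOver_of_ne_bot hp0 P
  -- every prime above `p` is `P` or `τ • P`
  have hconj : ∀ Q ∈ p.primesOver (𝓞 K), Q = P ∨ Q = τ • P := by
    intro Q hQ
    haveI := hQ.1
    haveI := hQ.2
    obtain ⟨σ, rfl⟩ := Ideal.exists_smul_eq_of_isGaloisGroup p P Q (K ≃ₐ[ℚ] K)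
    rcases eq_one_or_eq_of_card_eq_two hG hτ σ with h | h
    · exact Or.inl (by rw [h, one_smul])
    · exact Or.inr (by rw [h])
  have hτP : τ • P ∈ p.primesOver (𝓞 K) := by
    have hprime : (τ • P).IsPrime := Ideal.IsPrime.smul τ
    refine ⟨hprime, ⟨?_⟩⟩
    rw [Ideal.under_smul]
    exact hP.2.over
  have hne : P ≠ τ • P := by
    intro h
    have hsub : p.primesOver (𝓞 K) ⊆ {P} := by
      intro Q hQ
      rcases hconj Q hQ with h1 | h1
      · exact h1
      · rw [Set.mem_singleton_iff, h1, ← h]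
    have := Set.ncard_le_ncard hsub (Set.finite_singleton P)
    rw [hq2, Set.ncard_singleton] at this
    omega
  have hτP0 : τ • P ≠ ⊥ :=
    mem_nonZeroDivisors_iff_ne_zero.mp (smul_asIdeal_mem_nonZeroDivisors τ ⟨P, hP.1, hP0⟩)
  set v₁ : HeightOneSpectrum (𝓞 K) := ⟨P, hP.1, hP0⟩ with hv₁
  set v₂ : HeightOneSpectrum (𝓞 K) := ⟨τ • P, hτP.1, hτP0⟩ with hv₂
  -- `e = f = 1` and the factorisation `q𝓞_K = P · τP`
  have hefg := Ideal.ncard_primesOver_mul_ramificationIdxIn_mul_inertiaDegIn p (𝓞 K) (K ≃ₐ[ℚ] K)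
  rw [hG, hq2] at hefg
  have he1 : p.ramificationIdxIn (𝓞 K) = 1 := by
    have : p.ramificationIdxIn (𝓞 K) * p.inertiaDegIn (𝓞 K) = 1 := by omega
    exact Nat.eq_one_of_mul_eq_one_right this
  have hein : ∀ Q ∈ p.primesOver (𝓞 K), Q.ramificationIdx ℤ = 1 := by
    intro Q hQ
    haveI := hQ.1
    haveI := hQ.2
    rw [← Ideal.ramificationIdxIn_eq_ramificationIdx p Q (K ≃ₐ[ℚ] K), he1]
  have hset : p.primesOver (𝓞 K) = {P, τ • P} := by
    ext Q
    constructor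
    · intro hQ
      rcases hconj Q hQ with h | h
      · exact Or.inl h
      · exact Or.inr h
    · rintro (rfl | rfl)
      · exact hP
      · exact hτP
  have hfac : Ideal.span {(q : 𝓞 K)} = P * τ • P := by
    have h := Ideal.map_algebraMap_eq_finsetProd_pow (R := 𝓞 K) hp0
    have hmap : Ideal.map (algebraMap ℤ (𝓞 K)) p = Ideal.span {(q : 𝓞 K)} := by
      rw [hpdef, Ideal.map_span, Set.image_singleton, map_natCast]
    rw [← hmap, h]
    simp only [hset, Set.toFinset_insert, Set.toFinset_singleton]
    rw [Finset.prod_insert (by simpa using hne), Finset.prod_singleton, hein P hP,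
      hein (τ • P) hτP, pow_one, pow_one]
  -- `q ∈ P`
  have hqP : (q : 𝓞 K) ∈ P := by
    have : (q : 𝓞 K) ∈ Ideal.span {(q : 𝓞 K)} := Ideal.mem_span_singleton_self _
    rw [hfac] at this
    exact Ideal.mul_le_right this
  refine ⟨τ, v₁, v₂, hτ, fun h ↦ hne (congrArg HeightOneSpectrum.asIdeal h), rfl, hfac, hqP,
    fun v hv ↦ ?_⟩
  -- a prime containing `q` lies over `p`
  have hover : v.asIdeal ∈ p.primesOver (𝓞 K) := by
    refine ⟨v.isPrime, ⟨?_⟩⟩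
    have hle : p ≤ v.asIdeal.under ℤ := by
      rw [hpdef, Ideal.span_le, Set.singleton_subset_iff]
      show algebraMap ℤ (𝓞 K) q ∈ v.asIdeal
      rw [map_natCast]; exact hv
    haveI := v.isMaximal
    exact (hpmax.eq_of_le (Ideal.IsMaximal.under ℤ v.asIdeal).ne_top hle)
  rcases hconj v.asIdeal hover with h | h
  · exact Or.inl (HeightOneSpectrum.ext h)
  · exact Or.inr (HeightOneSpectrum.ext h)

/-! ### The two embeddings of `K` and the norm -/

/-- **`e k · γ₀(e k) = N_{K/ℚ}(k)`** for `γ₀ ∉ res Γ_K`: the two `ℚ`-embeddings `K → ℚ̄` are `e` and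
`γ₀ ∘ e` (`AlgHom.card = [K:ℚ] = 2`), and the norm is the product over all embeddings
(`Algebra.norm_eq_prod_embeddings`). [folklore] -/
theorem embedding_mul_smul_eq_norm {K : Type} [Field K] [NumberField K]
    (hK2 : Module.finrank ℚ K = 2) (e : K →ₐ[ℚ] AlgebraicClosure ℚ)
    (he : ∀ g : absoluteGaloisGroup ℚ, g ∈ (absGaloisRestrict ℚ K).range ↔ ∀ k : K, g • e k = e k)
    {γ₀ : absoluteGaloisGroup ℚ} (hγ₀ : γ₀ ∉ (absGaloisRestrict ℚ K).range) (k : K) :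
    e k * γ₀ • e k = algebraMap ℚ (AlgebraicClosure ℚ) (Algebra.norm ℚ k) := by
  classical
  set e' : K →ₐ[ℚ] AlgebraicClosure ℚ :=
    ((absoluteGaloisGroup.toAlgEquiv ℚ γ₀) : AlgebraicClosure ℚ ≃ₐ[ℚ] AlgebraicClosure ℚ).toAlgHom.comp e
    with he'
  have he'k : ∀ x : K, e' x = γ₀ • e x := fun x ↦ rfl
  have hne : e ≠ e' := by
    intro h
    apply hγ₀
    rw [he]
    intro x
    rw [← he'k, ← h]
  have hcard : Fintype.card (K →ₐ[ℚ] AlgebraicClosure ℚ) = 2 := by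
    rw [AlgHom.card ℚ K (AlgebraicClosure ℚ), hK2]
  have huniv : (Finset.univ : Finset (K →ₐ[ℚ] AlgebraicClosure ℚ)) = {e, e'} := by
    symm
    apply Finset.eq_of_subset_of_card_le (Finset.subset_univ _)
    rw [Finset.card_univ, hcard, Finset.card_pair hne]
  rw [Algebra.norm_eq_prod_embeddings ℚ (AlgebraicClosure ℚ) k, huniv, Finset.prod_pair hne, he'k]

/-! ### The Kummer exclusion for a generator of `𝔮^{ord [𝔮]}` -/

/-- **The Kummer exclusion KEX(β).** `K` imaginary quadratic, `p ≥ 5`, `ρ̄_{E,p}` onto, `ζ` a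
primitive `p^E`-th root of unity (`E ≥ 1`), `e` the embedding with fixed field `K`, `γ₀ ∉ res Γ_K`;
`q𝓞_K = 𝔮 𝔮'` split, `h = ord [𝔮]`, `𝔮^h = (β)`.  Then no `p`-th root `y` of `eβ / γ₀(eβ)` is fixed
by `res Γ_K ∩ Stab ζ ∩ ker ρ̄_{E,p}`: otherwise the descent (F3b-2) produces `δ ∈ K` with
`e(δ)^p = eβ/γ₀(eβ) = eβ²/N(β)`, i.e. `δ^p N(β) = β²`, excluded by F3b-1.
[cite: GrossLMS1991, §9 (Kummer theory in the proof of Prop. 9.5)] -/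
theorem kummerExclusion (W : WeierstrassCurve ℚ) [W.IsElliptic] {K : Type} [Field K] [NumberField K]
    (hK2 : Module.finrank ℚ K = 2) {p : ℕ} [Fact p.Prime] (hp5 : 5 ≤ p)
    (hsurj : W.HasSurjectiveModNGaloisRep p) {E : ℕ} [NeZero (p ^ E)] (hE : 1 ≤ E)
    {ζ : AlgebraicClosure ℚ} (hζ : IsPrimitiveRoot ζ (p ^ E)) (e : K →ₐ[ℚ] AlgebraicClosure ℚ)
    (he : ∀ g : absoluteGaloisGroup ℚ, g ∈ (absGaloisRestrict ℚ K).range ↔ ∀ k : K, g • e k = e k)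
    {γ₀ : absoluteGaloisGroup ℚ} (hγ₀ : γ₀ ∉ (absGaloisRestrict ℚ K).range)
    {q : ℕ} (hq : q.Prime) {v v' : HeightOneSpectrum (𝓞 K)} (hvv' : v ≠ v')
    (hfac : Ideal.span {(q : 𝓞 K)} = v.asIdeal * v'.asIdeal) {h : ℕ} (hh0 : 0 < h)
    (hord : ∀ n : ℕ, ClassGroup.mk0 ⟨v.asIdeal, mem_nonZeroDivisors_iff_ne_zero.mpr v.ne_bot⟩ ^ n = 1 →
      h ∣ n)
    {β : 𝓞 K} (hβ : v.asIdeal ^ h = Ideal.span {β}) :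
    ∀ y : AlgebraicClosure ℚ, y ^ p = e (β : K) * (γ₀ • e (β : K))⁻¹ →
      ∃ a : absoluteGaloisGroup ℚ, a ∈ (absGaloisRestrict ℚ K).range ∧ a • ζ = ζ ∧
        galoisRepTorsion W p a = 1 ∧ a • y ≠ y := by
  have hp : p.Prime := Fact.out
  have hp2 : p ≠ 2 := by omega
  haveI : Algebra.IsQuadraticExtension ℚ K := ⟨hK2⟩
  set H := (absGaloisRestrict ℚ K).range with hH
  have hHi : H.index = 2 := (index_range_absGaloisRestrict_eq_finrank ℚ K).trans hK2
  haveI hHn : H.Normal := Subgroup.normal_of_index_eq_two hHi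
  intro y hyp
  by_contra hcon
  simp only [not_exists, not_and, not_not] at hcon
  -- `x = eβ / γ₀(eβ)` is fixed by `H`
  set x := e (β : K) * (γ₀ • e (β : K))⁻¹ with hx
  have hfixβ : ∀ g ∈ H, g • e (β : K) = e (β : K) := fun g hg ↦ (he g).mp hg β
  have hfixβ' : ∀ g ∈ H, g • (γ₀ • e (β : K)) = γ₀ • e (β : K) := fun g hg ↦ by
    have hmem : γ₀⁻¹ * g * γ₀ ∈ H := hHn.conj_mem' g hg γ₀
    calc g • (γ₀ • e (β : K)) = γ₀ • ((γ₀⁻¹ * g * γ₀) • e (β : K)) := by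
          rw [mul_smul, mul_smul, smul_inv_smul]
      _ = γ₀ • e (β : K) := by rw [hfixβ _ hmem]
  have hxfix : ∀ g ∈ H, g • x = x := fun g hg ↦ by
    rw [hx, smul_mul', smul_inv'', hfixβ g hg, hfixβ' g hg]
  -- descent: `y` is fixed by `H ∩ Stab ζ`, then some `y₀` with `y₀^p = x` is fixed by `H`
  have hy1 : ∀ g ∈ H, g • ζ = ζ → g • y = y :=
    smul_eq_of_fixed_by_ker_galoisRep W hK2 hp5 hsurj hE hζ hxfix hyp
      (fun g hg hζg hρ ↦ hcon g hg hζg hρ)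
  obtain ⟨y₀, hy₀p, hy₀⟩ := exists_fixed_root_of_fixed_by_stabilizer hK2 hp5 hE hζ e he hxfix hyp hy1
  obtain ⟨δ, hδ⟩ := exists_eq_embedding_of_forall_smul e he hy₀
  -- `e(δ)^p · N(β) = e(β)²`
  have hnorm := embedding_mul_smul_eq_norm hK2 e he hγ₀ (β : K)
  have heβ0 : e (β : K) ≠ 0 := by
    rw [map_ne_zero_iff e e.injective, Ne, RingOfIntegers.coe_eq_zero_iff]
    intro h0
    refine pow_ne_zero h v.ne_bot ?_
    rw [hβ, h0]
    exact Ideal.span_singleton_eq_bot.mpr rfl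
  have hγβ0 : γ₀ • e (β : K) ≠ 0 := by rw [Ne, smul_eq_zero_iff_eq]; exact heβ0
  have hN : e (((Algebra.norm ℤ β : ℤ) : K)) =
      algebraMap ℚ (AlgebraicClosure ℚ) (Algebra.norm ℚ (β : K)) := by
    rw [← Algebra.coe_norm_int, map_intCast, map_intCast]
  have hK' : e (δ ^ p * ((Algebra.norm ℤ β : ℤ) : K)) = e ((β : K) ^ 2) := by
    rw [map_mul, map_pow, hδ, hy₀p, hx, hN, ← hnorm, map_pow]
    field_simp
  have hK : (δ ^ p * ((Algebra.norm ℤ β : ℤ) : K)) = (algebraMap (𝓞 K) K β) ^ 2 := by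
    rw [← RingOfIntegers.coe_eq_algebraMap]
    exact e.injective hK'
  exact not_exists_pow_mul_norm_eq_sq hK2 hq hvv' hfac hh0 hord hβ hp hp2 ⟨δ, hK⟩

/-! ### S3♭: the auxiliary prime supply -/

/-- **S3♭ `AuxiliaryPrimeSupply W K p q N` (the line's `stub_auxiliaryPrimeSupply`, definition
unfolded).** `K` imaginary quadratic with `d_K < -4`, `p ≥ 5` with `ρ̄_{E,p}` onto, `q` a prime
split in `K` (`#{𝔓 ∣ q} = 2`), `N ≠ 0`.  For every `E` and finite `T` there is a prime `ℓ₀ ∉ T`,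
`ℓ₀ ∤ N`, inert in `K`, with `p ∤ a_{ℓ₀}(W)` and `p^E ∣ orderOf [𝔭_v]_{ℓ₀}` in
`I_K(ℓ₀)/P_{K,ℤ}(ℓ₀)` for every prime `v ∋ q` of `K`.  Proof = F1 + F2 + F3a + F3b: witness
`γ` from `exists_preWitness` and `exists_witness_of_kummerExclusion` (KEX by `kummerExclusion`
for `β` a generator of `𝔮^{ord[𝔮]}`), auxiliary prime from `exists_auxPrime_of_frobeniusWitness`,
order divisibility from `RingClass.pow_dvd_orderOf_primeClass_of_inert` at `𝔮` and, via
`[𝔮][τ𝔮] = 1`, at `τ𝔮`. [cite: GrossLMS1991, §3 (p. 239: G_ℓ ≅ (𝒪_K/ℓ)^×/(ℤ/ℓ)^×)] [cite: Cox2013, §7.D (7.27), §9.A Lemma 9.3] -/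
theorem auxiliaryPrimeSupply (W : WeierstrassCurve ℚ) [W.IsElliptic] [W.IsGloballyMinimal]
    (K : Type) [Field K] [NumberField K] (hK : IsImaginaryQuadratic K)
    (hdK : NumberField.discr K < -4) (p : ℕ) [Fact p.Prime] (hp5 : 5 ≤ p)
    (hsurj : W.HasSurjectiveModNGaloisRep p) (q : ℕ) [Fact q.Prime]
    (hq2 : ((Ideal.span {(q : ℤ)}).primesOver (𝓞 K)).ncard = 2) (N : ℕ) (hN : N ≠ 0) :
    ∀ (E : ℕ) (T : Finset ℕ), ∃ ℓ₀ : ℕ, ℓ₀.Prime ∧ ℓ₀ ∉ T ∧ ¬ ℓ₀ ∣ N ∧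
      (Ideal.span {(ℓ₀ : 𝓞 K)}).IsPrime ∧ ¬ (p : ℤ) ∣ W.frobeniusTrace ℓ₀ ∧
      ∀ v : HeightOneSpectrum (𝓞 K), ((q : ℕ) : 𝓞 K) ∈ v.asIdeal →
        p ^ E ∣ orderOf (primeClass ℓ₀ v) := by
  classical
  intro E T
  have hp : p.Prime := Fact.out
  have hq : q.Prime := Fact.out
  have hK2 := hK.1
  haveI : Algebra.IsQuadraticExtension ℚ K := ⟨hK2⟩
  -- work at the exponent `E' = max E 1 ≥ 1`
  set E' := max E 1 with hE'
  have hE'1 : 1 ≤ E' := le_max_right _ _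
  have hEE' : p ^ E ∣ p ^ E' := pow_dvd_pow p (le_max_left _ _)
  haveI : NeZero (p ^ E') := ⟨pow_ne_zero _ hp.ne_zero⟩
  -- a primitive `p^E'`-th root of unity, the embedding `e`, the split primes, `β`
  obtain ⟨ζ, hζ⟩ := HasEnoughRootsOfUnity.exists_primitiveRoot (AlgebraicClosure ℚ) (p ^ E')
  obtain ⟨e, he⟩ := exists_mem_range_absGaloisRestrict_iff ℚ K
  obtain ⟨τ, v₁, v₂, hτ, hv12, hv₂, hfac, hqv₁, hall⟩ := exists_split_primes hK2 hq hq2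
  set c₁ := ClassGroup.mk0 ⟨v₁.asIdeal, mem_nonZeroDivisors_iff_ne_zero.mpr v₁.ne_bot⟩ with hc₁
  set h := orderOf c₁ with hh
  have hh0 : 0 < h := orderOf_pos c₁
  have hord : ∀ n : ℕ, c₁ ^ n = 1 → h ∣ n := fun n hn ↦ orderOf_dvd_of_pow_eq_one hn
  obtain ⟨β, hβ⟩ : ∃ β : 𝓞 K, v₁.asIdeal ^ h = Ideal.span {β} := by
    have hmk : (⟨v₁.asIdeal, mem_nonZeroDivisors_iff_ne_zero.mpr v₁.ne_bot⟩ : (Ideal (𝓞 K))⁰) ^ h =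
        ⟨v₁.asIdeal ^ h, mem_nonZeroDivisors_iff_ne_zero.mpr (pow_ne_zero h v₁.ne_bot)⟩ :=
      Subtype.ext (by rw [SubmonoidClass.coe_pow])
    have h1 : ClassGroup.mk0 ⟨v₁.asIdeal ^ h,
        mem_nonZeroDivisors_iff_ne_zero.mpr (pow_ne_zero h v₁.ne_bot)⟩ = 1 := by
      rw [← hmk, map_pow]
      exact pow_orderOf_eq_one c₁
    obtain ⟨⟨β, hβ⟩⟩ := (ClassGroup.mk0_eq_one_iff _).mp h1
    exact ⟨β, hβ⟩
  have hβ0 : β ≠ 0 := by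
    intro h0
    refine pow_ne_zero h v₁.ne_bot ?_
    rw [hβ, h0]
    exact Ideal.span_singleton_eq_bot.mpr rfl
  -- the Frobenius witness
  obtain ⟨γ₀, hγ₀H, hγ₀ζ, hγ₀tr⟩ := exists_preWitness W hK hp5 hsurj hE'1 hζ
  obtain ⟨α, hα⟩ := IsAlgClosed.exists_pow_nat_eq (e (β : K)) hp.pos
  have hα0 : α ≠ 0 := by
    intro h0
    have : e (β : K) = 0 := by rw [← hα, h0, zero_pow hp.ne_zero]
    rw [map_eq_zero_iff e e.injective, RingOfIntegers.coe_eq_zero_iff] at this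
    exact hβ0 this
  have hKEX := kummerExclusion W hK2 hp5 hsurj hE'1 hζ e he hγ₀H hq hv12 hfac hh0 hord hβ
  obtain ⟨γ, hγH, hγζ, hγtr, hγα⟩ :=
    exists_witness_of_kummerExclusion W hK hE'1 e hζ hα hα0 hγ₀H hγ₀ζ hγ₀tr hKEX
  -- the auxiliary prime, outside `T ∪ {q} ∪ primeFactors N`
  obtain ⟨ℓ₀, hℓ₀, hℓ₀T, hinert, hpE, haℓ, hkum⟩ :=
    exists_auxPrime_of_frobeniusWitness W hK hE'1 e hζ hα hγH hγζ hγtr hγα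
      (T ∪ {q} ∪ N.primeFactors)
  simp only [Finset.mem_union, Finset.mem_singleton, Nat.mem_primeFactors, not_or] at hℓ₀T
  obtain ⟨⟨hℓ₀T', hℓ₀q⟩, hℓ₀N⟩ := hℓ₀T
  have hℓ₀N' : ¬ ℓ₀ ∣ N := fun hd ↦ hℓ₀N ⟨hℓ₀, hd, hN⟩
  refine ⟨ℓ₀, hℓ₀, hℓ₀T', hℓ₀N', hinert, haℓ, fun v hv ↦ (hEE'.trans ?_)⟩
  -- `p ∤ ℓ₀ - 1` (as `p ∣ ℓ₀ + 1`, `p ≠ 2`)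
  have hpℓ : ¬ p ∣ ℓ₀ - 1 := by
    intro hd
    have h1 : p ∣ ℓ₀ + 1 := (dvd_pow_self p (by omega)).trans hpE
    have h2 : p ∣ (ℓ₀ + 1) - (ℓ₀ - 1) := Nat.dvd_sub h1 hd
    have h3 : (ℓ₀ + 1) - (ℓ₀ - 1) = 2 := by have := hℓ₀.one_le; omega
    rw [h3] at h2
    have := Nat.le_of_dvd two_pos h2
    omega
  -- at `𝔮 = v₁`
  have hv₁cop : v₁.asIdeal ⊔ Ideal.span {(ℓ₀ : 𝓞 K)} = ⊤ := by
    refine (sup_span_eq_top_iff_not_le ℓ₀).mpr ?_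
    intro hle
    have hmem : (ℓ₀ : 𝓞 K) ∈ v₁.asIdeal := hle (Ideal.mem_span_singleton_self _)
    have hcop : Nat.Coprime ℓ₀ q := (Nat.coprime_primes hℓ₀ hq).mpr hℓ₀q
    obtain ⟨a, b, hab⟩ : IsCoprime (ℓ₀ : ℤ) (q : ℤ) := Nat.isCoprime_iff_coprime.mpr hcop
    have h1 : ((a * ℓ₀ + b * q : ℤ) : 𝓞 K) ∈ v₁.asIdeal := by
      push_cast
      exact v₁.asIdeal.add_mem (v₁.asIdeal.mul_mem_left _ hmem) (v₁.asIdeal.mul_mem_left _ hqv₁)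
    rw [hab, Int.cast_one] at h1
    exact v₁.isPrime.ne_top ((Ideal.eq_top_iff_one _).mpr h1)
  have hdiv₁ : p ^ E' ∣ orderOf (primeClass ℓ₀ v₁) :=
    RingClass.pow_dvd_orderOf_primeClass_of_inert hK2 hdK hℓ₀ hinert hp hpE hpℓ hv₁cop hβ hkum
  rcases hall v hv with hv' | hv'
  · rw [hv']; exact hdiv₁
  · -- at `τ𝔮 = v₂`: `[v₁][v₂] = 1`, so the orders agree
    rw [hv']
    have hv₁' : ¬ Ideal.span {(ℓ₀ : 𝓞 K)} ≤ v₁.asIdeal := (sup_span_eq_top_iff_not_le ℓ₀).mp hv₁cop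
    have hmul := RingClass.primeClass_mul_primeClass_eq_one_of_smul hK2 τ hτ ℓ₀ hv₂ hv₁'
    have heq : primeClass ℓ₀ v₂ = (primeClass ℓ₀ v₁)⁻¹ := eq_inv_of_mul_eq_one_right hmul
    rw [heq, orderOf_inv]
    exact hdiv₁

end Summit.BirchSwinnertonDyer.BirchSwinnertonDyer.Theorems.AuxPrimeSupply

end
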